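import Summits.CriticalPhenomena.CardyFormulaZ2.Theorems.CardyUniqueLimitCardyRigidityDefs
import Literature.Probability.Process.MartingaleLimit
import Literature.Probability.Process.NestedStoppedMartingales
import Literature.Probability.Process.BrownianVecStoppedIncrements

/-!
# Crossing martingales: extension from inner levels to all levels (line `crossing-martingale`, crux `CardyRigidity`)

A closure property of the crossing-martingale property `IsCrossingMartingaleFamily f μ W 𝓕`
(vocabulary of `Theorems/CardyUniqueLimitCardyRigidityDefs.lean`; stub `stub_crossingMartingale`
of crux `CardyRigidity`, stmt-CriticalPhenomena-0746), needed by every passage of the martingale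
property from the lattice to a subsequential scaling limit through LEVEL-STOPPED observables:
the level stopping time `levelTime W x m M d` (first exit of the mark flows from the level box) is
not a continuous functional of the driving path, but it is continuous at every path exiting the
box transversally, which holds almost surely for all levels off a countable set; so a passage
theorem delivers the martingale property of `crossingObs f W x m M d` only for levels `(m, M, d)`
in a dense set, and this file upgrades it to ALL admissible levels.

THEOREM (`IsCrossingMartingaleFamily.of_innerLevels`).  Let `W` have continuous paths with
`W 0 = 0` on a finite measure space, `f` continuous on `(0,1)`.  Suppose that for every admissible
data `(x; m, M, d)` there are admissible levels `(mₖ, Mₖ, dₖ)` INSIDE (`m ≤ mₖ`, `Mₖ ≤ M`,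
`d ≤ dₖ`), monotone (`mₖ ↓`, `Mₖ ↑`, `dₖ ↓`) and converging to `(m, M, d)`, at which the
level-stopped crossing observables are `𝓕`-martingales.  Then `IsCrossingMartingaleFamily f μ W 𝓕`.

Proof.  Pathwise, the stopped clocks `t ∧ ρₖ` increase to `t ∧ ρ` (`tendsto_clock_exitTime`: an
increasing union of open level boxes; at a finite exit time the path sits on the boundary of the
`k`-th box, which converges to the boundary of the limit box, while strictly before `ρ` the path is
strictly inside — a contradiction unless `lim (t ∧ ρₖ) = t ∧ ρ`); the flows and the modulus are
continuous in time and `f` is continuous at the limit modulus, which lies in `(0,1)`; the stopped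
moduli of all the approximating levels lie in one compact subset of `(0,1)` on which `f` is
bounded; bounded pointwise limits of martingales are martingales
(`Process.martingale_of_tendsto_of_abs_le'`).
-/

noncomputable section

open MeasureTheory Filter Set Topology
open scoped NNReal ENNReal
open Literature.Probability.RandomPlanarGeometry
open Literature.Probability.Process (exitTime coe_untopA_min_le untopA_min_coe_le
  untopA_min_coe_top untopA_min_coe_coe mem_Ioo_of_coe_lt_exitTime
  apply_eq_or_eq_of_exitTime_eq_coe)

namespace Summit.CriticalPhenomena.CardyFormulaZ2.Cruxes.CardyRigidity.CrossingMartingale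

namespace LevelExtension

/-! ### The stopped clock `t ∧ c` read in `ℝ≥0` -/

/-- The stopped clock of a minimum of two times is the minimum of the stopped clocks.
[folklore] -/
theorem untopA_min_coe_min (t : ℝ≥0) (α β : WithTop ℝ≥0) :
    (min (t : WithTop ℝ≥0) (min α β)).untopA =
      min (min (t : WithTop ℝ≥0) α).untopA (min (t : WithTop ℝ≥0) β).untopA := by
  rw [← WithTop.coe_inj, WithTop.coe_min, Literature.Probability.Process.coe_untopA_min,
    Literature.Probability.Process.coe_untopA_min, Literature.Probability.Process.coe_untopA_min,
    min_min_min_comm (t : WithTop ℝ≥0) α (t : WithTop ℝ≥0) β, min_self]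

/-! ### Exit times from an increasing union of intervals -/

variable {Ω : Type*}

/-- **The stopped clocks of the exit times from inner intervals increase to the stopped clock
of the exit time.**  Let `u` be a continuous real path, `(aₖ, bₖ)` intervals inside `(a, b)`,
increasing (`aₖ ↓`, `bₖ ↑`) with `aₖ → a`, `bₖ → b`, all containing `u 0`.  Then for every
`t`, `t ∧ τ(aₖ, bₖ) → t ∧ τ(a, b)` (exit times `τ`, clocks read in `ℝ≥0`). [folklore] -/
theorem tendsto_clock_exitTime {u : ℝ≥0 → Ω → ℝ} {ω : Ω} (hc : Continuous fun s ↦ u s ω)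
    {a b : ℝ} {ak bk : ℕ → ℝ} (hak : Antitone ak) (hbk : Monotone bk)
    (hka : ∀ k, a ≤ ak k) (hkb : ∀ k, bk k ≤ b)
    (hta : Tendsto ak atTop (𝓝 a)) (htb : Tendsto bk atTop (𝓝 b))
    (h0 : ∀ k, u 0 ω ∈ Ioo (ak k) (bk k)) (t : ℝ≥0) :
    Tendsto (fun k ↦ (min (t : WithTop ℝ≥0) (exitTime u (ak k) (bk k) ω)).untopA) atTop
      (𝓝 (min (t : WithTop ℝ≥0) (exitTime u a b ω)).untopA) := by
  set τ : WithTop ℝ≥0 := exitTime u a b ω with hτ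
  set τk : ℕ → WithTop ℝ≥0 := fun k ↦ exitTime u (ak k) (bk k) ω with hτk
  set c : ℝ≥0 := (min (t : WithTop ℝ≥0) τ).untopA with hcdef
  set ck : ℕ → ℝ≥0 := fun k ↦ (min (t : WithTop ℝ≥0) (τk k)).untopA with hck
  -- monotonicity of exit times in the interval
  have hτk_le : ∀ k, τk k ≤ τ := fun k ↦
    hittingAfter_anti u 0 (compl_subset_compl.2 (Ioo_subset_Ioo (hka k) (hkb k))) ω
  have hτk_mono : Monotone τk := fun i j hij ↦
    hittingAfter_anti u 0 (compl_subset_compl.2 (Ioo_subset_Ioo (hak hij) (hbk hij))) ω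
  have hck_le : ∀ k, ck k ≤ c := fun k ↦
    Literature.Probability.Process.untopA_min_coe_le_of_le t (hτk_le k)
  have hck_mono : Monotone ck := fun i j hij ↦
    Literature.Probability.Process.untopA_min_coe_le_of_le t (hτk_mono hij)
  -- the clocks converge to their supremum `c'`
  have hbdd : BddAbove (range ck) := ⟨c, by rintro _ ⟨k, rfl⟩; exact hck_le k⟩
  have hconv : Tendsto ck atTop (𝓝 (⨆ k, ck k)) := tendsto_atTop_ciSup hck_mono hbdd
  set c' : ℝ≥0 := ⨆ k, ck k with hc'
  have hc'le : c' ≤ c := ciSup_le hck_le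
  suffices heq : c' = c by rwa [heq] at hconv
  by_contra hne
  have hlt : c' < c := lt_of_le_of_ne hc'le hne
  have hck_le' : ∀ k, ck k ≤ c' := fun k ↦ le_ciSup hbdd k
  have hct : c ≤ t := untopA_min_coe_le t τ
  -- every `τk` is finite, equal to `ck k < t`
  have hτk_eq : ∀ k, τk k = ((ck k : ℝ≥0) : WithTop ℝ≥0) := by
    intro k
    have hmin : min (t : WithTop ℝ≥0) (τk k) = ((ck k : ℝ≥0) : WithTop ℝ≥0) :=
      (Literature.Probability.Process.coe_untopA_min t (τk k)).symm
    have hlt' : ck k < t := lt_of_le_of_lt (hck_le' k) (hlt.trans_le hct)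
    have hne' : min (t : WithTop ℝ≥0) (τk k) ≠ (t : WithTop ℝ≥0) := by
      rw [hmin]; exact_mod_cast hlt'.ne
    rcases min_choice (t : WithTop ℝ≥0) (τk k) with h | h
    · exact absurd h hne'
    · rw [← h, hmin]
  -- at the finite exit time the path sits at an endpoint of the `k`-th interval
  have hend : ∀ k, u (ck k) ω = ak k ∨ u (ck k) ω = bk k := fun k ↦
    apply_eq_or_eq_of_exitTime_eq_coe hc (h0 k) (hτk_eq k)
  -- strictly before `τ` the path is strictly inside `(a, b)`
  have hc'τ : ((c' : ℝ≥0) : WithTop ℝ≥0) < τ := by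
    calc ((c' : ℝ≥0) : WithTop ℝ≥0) < c := WithTop.coe_lt_coe.2 hlt
      _ = min (t : WithTop ℝ≥0) τ := Literature.Probability.Process.coe_untopA_min t τ
      _ ≤ τ := min_le_right _ _
  have hin : u c' ω ∈ Ioo a b := mem_Ioo_of_coe_lt_exitTime hc'τ
  -- limits along the clocks
  have hu : Tendsto (fun k ↦ u (ck k) ω) atTop (𝓝 (u c' ω)) := (hc.tendsto c').comp hconv
  have hfreq : ∃ᶠ k in atTop, u (ck k) ω = ak k ∨ u (ck k) ω = bk k := Frequently.of_forall hend
  rcases frequently_or_distrib.1 hfreq with hfa | hfb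
  · haveI : (atTop ⊓ 𝓟 {k | u (ck k) ω = ak k}).NeBot := frequently_iff_neBot.1 hfa
    have h1 : Tendsto (fun k ↦ u (ck k) ω) (atTop ⊓ 𝓟 {k | u (ck k) ω = ak k}) (𝓝 (u c' ω)) :=
      hu.mono_left inf_le_left
    have h2 : Tendsto (fun k ↦ u (ck k) ω) (atTop ⊓ 𝓟 {k | u (ck k) ω = ak k}) (𝓝 a) :=
      (hta.mono_left inf_le_left).congr'
        (eventually_inf_principal.2 (Eventually.of_forall fun k hk ↦ hk.symm))
    have : u c' ω = a := tendsto_nhds_unique h1 h2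
    exact absurd this (ne_of_gt hin.1)
  · haveI : (atTop ⊓ 𝓟 {k | u (ck k) ω = bk k}).NeBot := frequently_iff_neBot.1 hfb
    have h1 : Tendsto (fun k ↦ u (ck k) ω) (atTop ⊓ 𝓟 {k | u (ck k) ω = bk k}) (𝓝 (u c' ω)) :=
      hu.mono_left inf_le_left
    have h2 : Tendsto (fun k ↦ u (ck k) ω) (atTop ⊓ 𝓟 {k | u (ck k) ω = bk k}) (𝓝 b) :=
      (htb.mono_left inf_le_left).congr'
        (eventually_inf_principal.2 (Eventually.of_forall fun k hk ↦ hk.symm))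
    have : u c' ω = b := tendsto_nhds_unique h1 h2
    exact absurd this (ne_of_lt hin.2)

/-! ### The mark flows at a clock before the level time live in the level box -/

variable {W : Ω → ℝ≥0 → ℝ} {x : Fin 3 → ℝ} {m M d : ℝ}

/-- Continuity and initial values of the three mark flows (positive marks, `W 0 = 0`).
[folklore] -/
theorem markFlow_continuous_and_zero (hWc : ∀ ω, Continuous (W ω)) (hW0 : ∀ ω, W ω 0 = 0)
    (h : AdmissibleLevels x m M d) (ω : Ω) (i : Fin 3) :
    (Continuous fun s ↦ markFlow W (x i) s ω) ∧ markFlow W (x i) 0 ω = x i := by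
  have hx0 : 0 < x 0 := h.pos
  have hne : x i ≠ W ω 0 := by
    rw [hW0 ω]
    exact (hx0.trans_le (h.strictMono.monotone (Fin.zero_le i))).ne'
  refine ⟨Loewner.continuous_realFlowStop_of_ne (hWc ω) hne, ?_⟩
  show Loewner.realFlowStop (W ω) (x i) 0 = x i
  rw [Loewner.realFlowStop_zero_of_ne (hWc ω) hne, hW0 ω, sub_zero]

/-- **The level box.**  At every clock `τ ≤ levelTime`, the first mark flow is in `[m, M]` and
the two gaps are in `[d, x₂ - x₀ + 1]`. [cite: Werner2007, §3] -/
theorem marks_mem_box (hWc : ∀ ω, Continuous (W ω)) (hW0 : ∀ ω, W ω 0 = 0)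
    (h : AdmissibleLevels x m M d) (ω : Ω) {τ : ℝ≥0}
    (hτ : (τ : WithTop ℝ≥0) ≤ levelTime W x m M d ω) :
    markFlow W (x 0) τ ω ∈ Icc m M ∧
      markFlow W (x 1) τ ω - markFlow W (x 0) τ ω ∈ Icc d (x 2 - x 0 + 1) ∧
      markFlow W (x 2) τ ω - markFlow W (x 1) τ ω ∈ Icc d (x 2 - x 0 + 1) := by
  have hx01 : x 0 < x 1 := h.strictMono (by decide)
  have hx12 : x 1 < x 2 := h.strictMono (by decide)
  have hcont := fun i ↦ (markFlow_continuous_and_zero hWc hW0 h ω i).1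
  have hzero := fun i ↦ (markFlow_continuous_and_zero hWc hW0 h ω i).2
  have hB₁ : x 1 - x 0 < x 2 - x 0 + 1 := by linarith
  have hB₂ : x 2 - x 1 < x 2 - x 0 + 1 := by linarith
  refine ⟨?_, ?_, ?_⟩
  · refine mem_Icc_of_le_exitTime (hcont 0) ?_ (hτ.trans (min_le_left _ _))
    rw [hzero 0]; exact ⟨h.m_lt, h.lt_M⟩
  · refine mem_Icc_of_le_exitTime (u := fun s ω ↦ markFlow W (x 1) s ω - markFlow W (x 0) s ω)
      ((hcont 1).sub (hcont 0)) ?_ (hτ.trans ((min_le_right _ _).trans (min_le_left _ _)))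
    show markFlow W (x 1) 0 ω - markFlow W (x 0) 0 ω ∈ Ioo d (x 2 - x 0 + 1)
    rw [hzero 1, hzero 0]; exact ⟨h.d_lt₁, hB₁⟩
  · refine mem_Icc_of_le_exitTime (u := fun s ω ↦ markFlow W (x 2) s ω - markFlow W (x 1) s ω)
      ((hcont 2).sub (hcont 1)) ?_ (hτ.trans ((min_le_right _ _).trans (min_le_right _ _)))
    show markFlow W (x 2) 0 ω - markFlow W (x 1) 0 ω ∈ Ioo d (x 2 - x 0 + 1)
    rw [hzero 2, hzero 1]; exact ⟨h.d_lt₂, hB₂⟩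

/-- **A uniform bound for the stopped crossing observables of inner levels.**  For admissible
`(x; m, M, d)` and `f` continuous on `(0,1)` there is `B` such that
`|crossingObs f W x m' M' d' t ω| ≤ B` for all admissible inner levels `m ≤ m'`, `M' ≤ M`,
`d ≤ d'`, all `t` and `ω`. [folklore] -/
theorem exists_bound_crossingObs {f : ℝ → ℝ} (hf : ContinuousOn f (Ioo 0 1))
    (hWc : ∀ ω, Continuous (W ω)) (hW0 : ∀ ω, W ω 0 = 0) (h : AdmissibleLevels x m M d) :
    ∃ B : ℝ, ∀ (m' M' d' : ℝ), m ≤ m' → M' ≤ M → d ≤ d' → AdmissibleLevels x m' M' d' →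
      ∀ (t : ℝ≥0) (ω : Ω), |crossingObs f W x m' M' d' t ω| ≤ B := by
  set G : ℝ := x 2 - x 0 + 1 with hG
  -- the modulus as a function of the first mark and the two gaps, on the limit box
  set Φ : ℝ × ℝ × ℝ → ℝ := fun p ↦ cardyEta p.1 (p.1 + p.2.1) (p.1 + p.2.1 + p.2.2) with hΦ
  set box : Set (ℝ × ℝ × ℝ) := Icc m M ×ˢ Icc d G ×ˢ Icc d G with hbox
  have hpos : ∀ p ∈ box, 0 < p.1 ∧ 0 < p.2.1 ∧ 0 < p.2.2 := by
    rintro p ⟨hp0, hp1, hp2⟩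
    exact ⟨h.m_pos.trans_le hp0.1, h.d_pos.trans_le hp1.1, h.d_pos.trans_le hp2.1⟩
  have hΦc : ContinuousOn Φ box := by
    intro p hp
    obtain ⟨h1, h2, h3⟩ := hpos p hp
    refine ContinuousAt.continuousWithinAt ?_
    have hden : (p.1 + p.2.1) * (p.1 + p.2.1 + p.2.2 - p.1) ≠ 0 := by
      have hA : 0 < p.1 + p.2.1 := by linarith
      have hB : 0 < p.1 + p.2.1 + p.2.2 - p.1 := by linarith
      exact (mul_pos hA hB).ne'
    simp only [hΦ, cardyEta]
    refine ContinuousAt.div ?_ ?_ hden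
    · exact continuousAt_fst.mul
        ((continuousAt_fst.add (continuousAt_fst.comp continuousAt_snd)).add
          (continuousAt_snd.comp continuousAt_snd) |>.sub
          (continuousAt_fst.add (continuousAt_fst.comp continuousAt_snd)))
    · exact (continuousAt_fst.add (continuousAt_fst.comp continuousAt_snd)).mul
        (((continuousAt_fst.add (continuousAt_fst.comp continuousAt_snd)).add
          (continuousAt_snd.comp continuousAt_snd)).sub continuousAt_fst)
  have hΦmem : ∀ p ∈ box, Φ p ∈ Ioo (0 : ℝ) 1 := by
    intro p hp
    obtain ⟨h1, h2, h3⟩ := hpos p hp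
    exact cardyEta_mem_Ioo h1 (by linarith) (by linarith)
  set K : Set ℝ := Φ '' box with hK
  have hKc : IsCompact K :=
    (isCompact_Icc.prod (isCompact_Icc.prod isCompact_Icc)).image_of_continuousOn hΦc
  have hKsub : K ⊆ Ioo 0 1 := by
    rintro _ ⟨p, hp, rfl⟩
    exact hΦmem p hp
  obtain ⟨B, hB⟩ := hKc.exists_bound_of_continuousOn (hf.mono hKsub)
  refine ⟨B, fun m' M' d' hm' hM' hd' h' t ω ↦ ?_⟩
  set τ : ℝ≥0 := (min (t : WithTop ℝ≥0) (levelTime W x m' M' d' ω)).untopA with hτdef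
  have hτρ : (τ : WithTop ℝ≥0) ≤ levelTime W x m' M' d' ω := coe_untopA_min_le t _
  obtain ⟨hX0, hg1, hg2⟩ := marks_mem_box hWc hW0 h' ω hτρ
  -- the stopped marks of the inner levels lie in the limit box
  have hmem : (markFlow W (x 0) τ ω, markFlow W (x 1) τ ω - markFlow W (x 0) τ ω,
      markFlow W (x 2) τ ω - markFlow W (x 1) τ ω) ∈ box :=
    ⟨⟨hm'.trans hX0.1, hX0.2.trans hM'⟩, ⟨hd'.trans hg1.1, hg1.2⟩, ⟨hd'.trans hg2.1, hg2.2⟩⟩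
  have hval : crossingObs f W x m' M' d' t ω = f (Φ (markFlow W (x 0) τ ω,
      markFlow W (x 1) τ ω - markFlow W (x 0) τ ω,
      markFlow W (x 2) τ ω - markFlow W (x 1) τ ω)) := by
    show f (etaProc W x τ ω) = _
    simp only [hΦ, etaProc]
    congr 1
    congr 1 <;> ring
  rw [hval, ← Real.norm_eq_abs]
  exact hB _ ⟨_, hmem, rfl⟩

/-! ### Pathwise convergence of the stopped observables along inner levels -/

/-- **The stopped clocks of inner level boxes converge to the stopped clock of the limit box.**
[folklore] -/
theorem tendsto_clock_levelTime (hWc : ∀ ω, Continuous (W ω)) (hW0 : ∀ ω, W ω 0 = 0)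
    (h : AdmissibleLevels x m M d) {mk Mk dk : ℕ → ℝ} (hmk : Antitone mk) (hMk : Monotone Mk)
    (hdk : Antitone dk) (htm : Tendsto mk atTop (𝓝 m)) (htM : Tendsto Mk atTop (𝓝 M))
    (htd : Tendsto dk atTop (𝓝 d))
    (hk : ∀ k, m ≤ mk k ∧ Mk k ≤ M ∧ d ≤ dk k ∧ AdmissibleLevels x (mk k) (Mk k) (dk k))
    (t : ℝ≥0) (ω : Ω) :
    Tendsto (fun k ↦ (min (t : WithTop ℝ≥0) (levelTime W x (mk k) (Mk k) (dk k) ω)).untopA)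
      atTop (𝓝 (min (t : WithTop ℝ≥0) (levelTime W x m M d ω)).untopA) := by
  have hcont := fun i ↦ (markFlow_continuous_and_zero hWc hW0 h ω i).1
  have hzero := fun i ↦ (markFlow_continuous_and_zero hWc hW0 h ω i).2
  have hx01 : x 0 < x 1 := h.strictMono (by decide)
  have hx12 : x 1 < x 2 := h.strictMono (by decide)
  -- the three coordinates
  have h₀ : Tendsto (fun k ↦ (min (t : WithTop ℝ≥0)
      (exitTime (markFlow W (x 0)) (mk k) (Mk k) ω)).untopA) atTop
      (𝓝 (min (t : WithTop ℝ≥0) (exitTime (markFlow W (x 0)) m M ω)).untopA) := by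
    refine tendsto_clock_exitTime (hcont 0) hmk hMk (fun k ↦ (hk k).1) (fun k ↦ (hk k).2.1)
      htm htM (fun k ↦ ?_) t
    rw [hzero 0]; exact ⟨(hk k).2.2.2.m_lt, (hk k).2.2.2.lt_M⟩
  have h₁ : Tendsto (fun k ↦ (min (t : WithTop ℝ≥0)
      (exitTime (fun s ω ↦ markFlow W (x 1) s ω - markFlow W (x 0) s ω) (dk k)
        (x 2 - x 0 + 1) ω)).untopA) atTop
      (𝓝 (min (t : WithTop ℝ≥0) (exitTime (fun s ω ↦ markFlow W (x 1) s ω - markFlow W (x 0) s ω)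
        d (x 2 - x 0 + 1) ω)).untopA) := by
    refine tendsto_clock_exitTime (u := fun s ω ↦ markFlow W (x 1) s ω - markFlow W (x 0) s ω)
      ((hcont 1).sub (hcont 0)) hdk monotone_const (fun k ↦ (hk k).2.2.1) (fun _ ↦ le_rfl)
      htd tendsto_const_nhds (fun k ↦ ?_) t
    show markFlow W (x 1) 0 ω - markFlow W (x 0) 0 ω ∈ Ioo (dk k) (x 2 - x 0 + 1)
    rw [hzero 1, hzero 0]; exact ⟨(hk k).2.2.2.d_lt₁, by linarith⟩
  have h₂ : Tendsto (fun k ↦ (min (t : WithTop ℝ≥0)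
      (exitTime (fun s ω ↦ markFlow W (x 2) s ω - markFlow W (x 1) s ω) (dk k)
        (x 2 - x 0 + 1) ω)).untopA) atTop
      (𝓝 (min (t : WithTop ℝ≥0) (exitTime (fun s ω ↦ markFlow W (x 2) s ω - markFlow W (x 1) s ω)
        d (x 2 - x 0 + 1) ω)).untopA) := by
    refine tendsto_clock_exitTime (u := fun s ω ↦ markFlow W (x 2) s ω - markFlow W (x 1) s ω)
      ((hcont 2).sub (hcont 1)) hdk monotone_const (fun k ↦ (hk k).2.2.1) (fun _ ↦ le_rfl)
      htd tendsto_const_nhds (fun k ↦ ?_) t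
    show markFlow W (x 2) 0 ω - markFlow W (x 1) 0 ω ∈ Ioo (dk k) (x 2 - x 0 + 1)
    rw [hzero 2, hzero 1]; exact ⟨(hk k).2.2.2.d_lt₂, by linarith⟩
  -- the level time is the minimum of the three
  have hsplit : ∀ (m' M' d' : ℝ), (min (t : WithTop ℝ≥0) (levelTime W x m' M' d' ω)).untopA =
      min (min (t : WithTop ℝ≥0) (exitTime (markFlow W (x 0)) m' M' ω)).untopA
        (min (min (t : WithTop ℝ≥0) (exitTime (fun s ω ↦ markFlow W (x 1) s ω - markFlow W (x 0) s ω)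
          d' (x 2 - x 0 + 1) ω)).untopA
          (min (t : WithTop ℝ≥0) (exitTime (fun s ω ↦ markFlow W (x 2) s ω - markFlow W (x 1) s ω)
          d' (x 2 - x 0 + 1) ω)).untopA) := by
    intro m' M' d'
    simp only [levelTime]
    rw [untopA_min_coe_min, untopA_min_coe_min]
  simp only [hsplit]
  exact h₀.min (h₁.min h₂)

/-- **Pathwise convergence of the stopped crossing observables along inner levels.**
[folklore] -/
theorem tendsto_crossingObs_levels {f : ℝ → ℝ} (hf : ContinuousOn f (Ioo 0 1))
    (hWc : ∀ ω, Continuous (W ω)) (hW0 : ∀ ω, W ω 0 = 0)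
    (h : AdmissibleLevels x m M d) {mk Mk dk : ℕ → ℝ} (hmk : Antitone mk) (hMk : Monotone Mk)
    (hdk : Antitone dk) (htm : Tendsto mk atTop (𝓝 m)) (htM : Tendsto Mk atTop (𝓝 M))
    (htd : Tendsto dk atTop (𝓝 d))
    (hk : ∀ k, m ≤ mk k ∧ Mk k ≤ M ∧ d ≤ dk k ∧ AdmissibleLevels x (mk k) (Mk k) (dk k))
    (t : ℝ≥0) (ω : Ω) :
    Tendsto (fun k ↦ crossingObs f W x (mk k) (Mk k) (dk k) t ω) atTop
      (𝓝 (crossingObs f W x m M d t ω)) := by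
  have hcont := fun i ↦ (markFlow_continuous_and_zero hWc hW0 h ω i).1
  set c : ℝ≥0 := (min (t : WithTop ℝ≥0) (levelTime W x m M d ω)).untopA with hcdef
  have hclock := tendsto_clock_levelTime hWc hW0 h hmk hMk hdk htm htM htd hk t ω
  -- the modulus is continuous in time at the limit clock
  have hcρ : (c : WithTop ℝ≥0) ≤ levelTime W x m M d ω := coe_untopA_min_le t _
  obtain ⟨hX0, hg1, hg2⟩ := marks_mem_box hWc hW0 h ω hcρ
  have hpos0 : 0 < markFlow W (x 0) c ω := h.m_pos.trans_le hX0.1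
  have hpos1 : 0 < markFlow W (x 1) c ω := by linarith [hg1.1, h.d_pos]
  have hden : markFlow W (x 1) c ω * (markFlow W (x 2) c ω - markFlow W (x 0) c ω) ≠ 0 := by
    have : 0 < markFlow W (x 2) c ω - markFlow W (x 0) c ω := by linarith [hg1.1, hg2.1, h.d_pos]
    positivity
  have heta : ContinuousAt (fun s ↦ etaProc W x s ω) c := by
    simp only [etaProc, cardyEta]
    exact (((hcont 0).continuousAt).mul
      ((hcont 2).continuousAt.sub (hcont 1).continuousAt)).div
      (((hcont 1).continuousAt).mul ((hcont 2).continuousAt.sub (hcont 0).continuousAt)) hden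
  have hηmem : etaProc W x c ω ∈ Ioo (0 : ℝ) 1 := etaProc_stopped_mem_Ioo hWc hW0 h t ω
  have hfc : ContinuousAt f (etaProc W x c ω) := hf.continuousAt (Ioo_mem_nhds hηmem.1 hηmem.2)
  have := (hfc.tendsto.comp (heta.tendsto.comp hclock))
  exact this

end LevelExtension

open LevelExtension in
/-- **Extension of the crossing-martingale property from inner levels to all levels** (see the
module docstring).  If, for every admissible `(x; m, M, d)`, the level-stopped crossing observables
are martingales along admissible inner levels `mₖ ↓ m`, `Mₖ ↑ M`, `dₖ ↓ d`, then they are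
martingales at every admissible level. [cite: RevuzYor1999, Ch. II §1] -/
theorem IsCrossingMartingaleFamily.of_innerLevels {Ω : Type*} [MeasurableSpace Ω]
    {μ : Measure Ω} [IsFiniteMeasure μ] {W : Ω → ℝ≥0 → ℝ}
    {𝓕 : Filtration ℝ≥0 ‹MeasurableSpace Ω›} {f : ℝ → ℝ} (hf : ContinuousOn f (Ioo 0 1))
    (hWc : ∀ ω, Continuous (W ω)) (hW0 : ∀ ω, W ω 0 = 0)
    (h : ∀ (x : Fin 3 → ℝ) (m M d : ℝ), AdmissibleLevels x m M d →
      ∃ (mk Mk dk : ℕ → ℝ), Antitone mk ∧ Monotone Mk ∧ Antitone dk ∧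
        Tendsto mk atTop (𝓝 m) ∧ Tendsto Mk atTop (𝓝 M) ∧ Tendsto dk atTop (𝓝 d) ∧
        ∀ k, m ≤ mk k ∧ Mk k ≤ M ∧ d ≤ dk k ∧ AdmissibleLevels x (mk k) (Mk k) (dk k) ∧
          Martingale (crossingObs f W x (mk k) (Mk k) (dk k)) 𝓕 μ) :
    IsCrossingMartingaleFamily f μ W 𝓕 := by
  intro x m M d hadm
  obtain ⟨mk, Mk, dk, hmk, hMk, hdk, htm, htM, htd, hk⟩ := h x m M d hadm
  obtain ⟨B, hB⟩ := exists_bound_crossingObs (W := W) hf hWc hW0 hadm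
  have hk' : ∀ k, m ≤ mk k ∧ Mk k ≤ M ∧ d ≤ dk k ∧ AdmissibleLevels x (mk k) (Mk k) (dk k) :=
    fun k ↦ ⟨(hk k).1, (hk k).2.1, (hk k).2.2.1, (hk k).2.2.2.1⟩
  refine Literature.Probability.Process.martingale_of_tendsto_of_abs_le'
    (M := fun k ↦ crossingObs f W x (mk k) (Mk k) (dk k)) (fun k ↦ (hk k).2.2.2.2)
    (C := fun _ ↦ B) (fun k t ω ↦ hB _ _ _ (hk k).1 (hk k).2.1 (hk k).2.2.1 (hk k).2.2.2.1 t ω)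
    fun t ω ↦ ?_
  exact tendsto_crossingObs_levels hf hWc hW0 hadm hmk hMk hdk htm htM htd hk' t ω

/-- **Registered form** (glue sub-goal `crossingMartingale_of_innerLevels` of stmt-CriticalPhenomena-0746): the
crossing-martingale property extends from inner levels increasing to the box to all admissible levels.
[cite: RevuzYor1999, Ch. II §1] -/
theorem crossingMartingale_of_innerLevels : ∀ {Ω : Type*} {mΩ : MeasurableSpace Ω} {μ : MeasureTheory.Measure Ω} [MeasureTheory.IsFiniteMeasure μ] {W : Ω → ℝ≥0 → ℝ} {𝓕 : MeasureTheory.Filtration ℝ≥0 mΩ} {f : ℝ → ℝ}, ContinuousOn f (Set.Ioo 0 1) → (∀ ω, Continuous (W ω)) → (∀ ω, W ω 0 = 0) → (∀ (x : Fin 3 → ℝ) (m M d : ℝ), AdmissibleLevels x m M d → ∃ mk Mk dk : ℕ → ℝ, Antitone mk ∧ Monotone Mk ∧ Antitone dk ∧ Filter.Tendsto mk Filter.atTop (nhds m) ∧ Filter.Tendsto Mk Filter.atTop (nhds M) ∧ Filter.Tendsto dk Filter.atTop (nhds d) ∧ ∀ k, m ≤ mk k ∧ Mk k ≤ M ∧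 d ≤ dk k ∧ AdmissibleLevels x (mk k) (Mk k) (dk k) ∧ MeasureTheory.Martingale (crossingObs f W x (mk k) (Mk k) (dk k)) 𝓕 μ) → IsCrossingMartingaleFamily f μ W 𝓕 :=
  fun hf hWc hW0 h ↦ IsCrossingMartingaleFamily.of_innerLevels hf hWc hW0 h

end Summit.CriticalPhenomena.CardyFormulaZ2.Cruxes.CardyRigidity.CrossingMartingale

end
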